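import Mathlib.Data.Finset.Powerset
import Mathlib.Data.Nat.Choose.Basic
import Mathlib.Algebra.Order.BigOperators.Group.Finset
import Mathlib.Algebra.BigOperators.Ring.Finset
import Mathlib.Data.Real.Basic
import Mathlib.Tactic.FieldSimp
import Mathlib.Tactic.Linarith
import Mathlib.Tactic.LinearCombination
import Mathlib.Tactic.Positivity
import Mathlib.Tactic.Ring
import HarnessLib

/-!
# Sampling a `k`-subset: the second-moment method for many targets at once

Topic `Literature/Combinatorics/Extremal`. Everything in this file is PROVED.

A deterministic substitute for the "random subset" step of the Guth–Katz degree reduction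
[GuthKatz2015, §3–4 ("we select a random subset … with positive probability … each line of
`𝔏'` will intersect lines of `𝔏''` in at least `N` different points")]. For a uniformly random
`k`-subset `T` of a `b`-set `M` and a fixed `S ⊆ M`, `|S ∩ T|` is hypergeometric with mean
`μ = |S|k/b` and variance `≤ μ`; by Chebyshev, `|S ∩ T| ≤ μ/2` happens for at most a fraction
`4/μ` of the subsets `T` (`card_filter_small_le`). Summing over a family of targets `Sᵢ` and
averaging over `T` (`exists_subset_few_small`): some `k`-subset `T` is "bad" (meets `Sᵢ` in at
most `μᵢ/2` elements) for at most `∑ᵢ 4b/(|Sᵢ| k)` indices `i`. No independence, no Chernoff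
bound and no union bound are needed — failed targets are simply paid for.

The exact first and second factorial moments (`sum_card_inter_powersetCard`,
`sum_card_inter_mul_pred_powersetCard`) come from the bijection between `k`-subsets containing
a point and `(k-1)`-subsets of the rest (`card_filter_mem_powersetCard`).

## References
* [GuthKatz2015] L. Guth, N. H. Katz, *On the Erdős distinct distances problem in the plane*,
  Ann. of Math. 181 (2015) 155–190, §3 (degree reduction by random sampling).
-/

namespace Literature.Combinatorics.Extremal

open Finset

/-! ### Subsets through one or two given points -/

section PowersetCard

variable {α : Type*} [DecidableEq α]

/-- `k`-subsets of `M` containing `x` and satisfying a condition on the rest correspond to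
`(k-1)`-subsets of `M ∖ {x}` satisfying the condition (erase/insert `x`). [folklore] -/
theorem card_filter_mem_powersetCard (M : Finset α) {x : α} (hx : x ∈ M) {k : ℕ} (hk : 1 ≤ k)
    (q : Finset α → Prop) [DecidablePred q] :
    ((M.powersetCard k).filter fun T => x ∈ T ∧ q (T.erase x)).card =
      (((M.erase x).powersetCard (k - 1)).filter q).card := by
  refine card_bij' (fun T _ => T.erase x) (fun T' _ => insert x T') ?_ ?_ ?_ ?_
  · intro T hT
    rw [mem_filter, mem_powersetCard] at hT
    obtain ⟨⟨hTM, hTk⟩, hxT, hq⟩ := hT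
    rw [mem_filter, mem_powersetCard]
    exact ⟨⟨erase_subset_erase x hTM, by rw [card_erase_of_mem hxT, hTk]⟩, hq⟩
  · intro T' hT'
    rw [mem_filter, mem_powersetCard] at hT'
    obtain ⟨⟨hT'M, hT'k⟩, hq⟩ := hT'
    have hxT' : x ∉ T' := fun h => notMem_erase x M (hT'M h)
    rw [mem_filter, mem_powersetCard]
    refine ⟨⟨?_, ?_⟩, mem_insert_self x T', ?_⟩
    · exact insert_subset hx (hT'M.trans (erase_subset x M))
    · rw [card_insert_of_notMem hxT', hT'k]
      omega
    · rwa [erase_insert hxT']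
  · intro T hT
    rw [mem_filter] at hT
    exact insert_erase hT.2.1
  · intro T' hT'
    rw [mem_filter, mem_powersetCard] at hT'
    exact erase_insert fun h => notMem_erase x M (hT'.1.1 h)

/-- The number of `k`-subsets of a `b`-set containing a given point is `C(b-1, k-1)`.
[folklore] -/
theorem card_filter_mem_powersetCard_eq_choose (M : Finset α) {x : α} (hx : x ∈ M) {k : ℕ}
    (hk : 1 ≤ k) :
    ((M.powersetCard k).filter fun T => x ∈ T).card = (M.card - 1).choose (k - 1) := by
  have h := card_filter_mem_powersetCard M hx hk (fun _ => True)
  simp only [and_true] at h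
  rw [h, filter_true_of_mem (fun _ _ => trivial), card_powersetCard, card_erase_of_mem hx]

/-- The number of `k`-subsets of a `b`-set containing two given points is `C(b-2, k-2)`.
[folklore] -/
theorem card_filter_pair_mem_powersetCard_eq_choose (M : Finset α) {x y : α} (hx : x ∈ M)
    (hy : y ∈ M) (hxy : x ≠ y) {k : ℕ} (hk : 2 ≤ k) :
    ((M.powersetCard k).filter fun T => x ∈ T ∧ y ∈ T).card = (M.card - 2).choose (k - 2) := by
  have h := card_filter_mem_powersetCard M hx (by omega : 1 ≤ k) (fun T' => y ∈ T')
  have h' : ((M.powersetCard k).filter fun T => x ∈ T ∧ y ∈ T) =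
      (M.powersetCard k).filter fun T => x ∈ T ∧ y ∈ T.erase x := by
    refine filter_congr fun T _ => ?_
    rw [mem_erase]
    exact ⟨fun ⟨h1, h2⟩ => ⟨h1, hxy.symm, h2⟩, fun ⟨h1, _, h2⟩ => ⟨h1, h2⟩⟩
  rw [h', h, card_filter_mem_powersetCard_eq_choose (M.erase x) (mem_erase.2 ⟨hxy.symm, hy⟩)
    (by omega : 1 ≤ k - 1), card_erase_of_mem hx,
    show M.card - 1 - 1 = M.card - 2 by omega, show k - 1 - 1 = k - 2 by omega]

/-- **First factorial moment**: `∑_T |S ∩ T| = |S| · C(b-1, k-1)` over the `k`-subsets `T` of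
`M ⊇ S`. [folklore] -/
theorem sum_card_inter_powersetCard (M S : Finset α) (hS : S ⊆ M) {k : ℕ} (hk : 1 ≤ k) :
    ∑ T ∈ M.powersetCard k, (S ∩ T).card = S.card * (M.card - 1).choose (k - 1) := by
  calc ∑ T ∈ M.powersetCard k, (S ∩ T).card
      = ∑ T ∈ M.powersetCard k, ∑ x ∈ S, (if x ∈ T then 1 else 0) := by
        refine sum_congr rfl fun T _ => ?_
        rw [sum_ite_mem, card_eq_sum_ones]
    _ = ∑ x ∈ S, ∑ T ∈ M.powersetCard k, (if x ∈ T then 1 else 0) := sum_comm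
    _ = ∑ x ∈ S, ((M.powersetCard k).filter fun T => x ∈ T).card := by
        refine sum_congr rfl fun x _ => ?_
        rw [sum_boole, Nat.cast_id]
    _ = ∑ x ∈ S, (M.card - 1).choose (k - 1) :=
        sum_congr rfl fun x hx => card_filter_mem_powersetCard_eq_choose M (hS hx) hk
    _ = S.card * (M.card - 1).choose (k - 1) := by rw [sum_const, smul_eq_mul]

/-- **Second factorial moment**: `∑_T |S ∩ T| (|S ∩ T| - 1) = |S| (|S| - 1) C(b-2, k-2)` over
the `k`-subsets `T` of `M ⊇ S`, `k ≥ 2`. [folklore] -/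
theorem sum_card_inter_mul_pred_powersetCard (M S : Finset α) (hS : S ⊆ M) {k : ℕ}
    (hk : 2 ≤ k) :
    ∑ T ∈ M.powersetCard k, (S ∩ T).card * ((S ∩ T).card - 1) =
      S.card * (S.card - 1) * (M.card - 2).choose (k - 2) := by
  have hoff : ∀ T : Finset α, (S ∩ T).card * ((S ∩ T).card - 1) =
      ∑ p ∈ S.offDiag, (if p.1 ∈ T ∧ p.2 ∈ T then 1 else 0) := by
    intro T
    rw [Nat.mul_sub_one, ← offDiag_card, sum_boole, Nat.cast_id]
    congr 1
    ext p
    simp only [mem_offDiag, mem_inter, mem_filter]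
    tauto
  calc ∑ T ∈ M.powersetCard k, (S ∩ T).card * ((S ∩ T).card - 1)
      = ∑ T ∈ M.powersetCard k, ∑ p ∈ S.offDiag, (if p.1 ∈ T ∧ p.2 ∈ T then 1 else 0) :=
        sum_congr rfl fun T _ => hoff T
    _ = ∑ p ∈ S.offDiag, ∑ T ∈ M.powersetCard k, (if p.1 ∈ T ∧ p.2 ∈ T then 1 else 0) :=
        sum_comm
    _ = ∑ p ∈ S.offDiag, ((M.powersetCard k).filter fun T => p.1 ∈ T ∧ p.2 ∈ T).card := by
        refine sum_congr rfl fun p _ => ?_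
        rw [sum_boole, Nat.cast_id]
    _ = ∑ p ∈ S.offDiag, (M.card - 2).choose (k - 2) := by
        refine sum_congr rfl fun p hp => ?_
        rw [mem_offDiag] at hp
        exact card_filter_pair_mem_powersetCard_eq_choose M (hS hp.1) (hS hp.2.1) hp.2.2 hk
    _ = S.card * (S.card - 1) * (M.card - 2).choose (k - 2) := by
        rw [sum_const, smul_eq_mul, offDiag_card, Nat.mul_sub_one]

end PowersetCard

/-! ### Chebyshev for one target, and averaging over many -/

section Chebyshev

variable {α : Type*} [DecidableEq α]

/-- **Chebyshev for the hypergeometric count.** Among the `k`-subsets `T` of the `b`-set `M`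
(`2 ≤ k ≤ b`), those meeting a fixed nonempty `S ⊆ M` in at most half the expected number
`|S|k/b` of elements — precisely, `2b|S ∩ T| ≤ |S|k` — number at most `4 C(b,k) · b/(|S|k)`:
the variance of `|S ∩ T|` is at most its mean. [folklore] -/
theorem card_filter_small_le (M S : Finset α) (hS : S ⊆ M) (hσ : 1 ≤ S.card) {k : ℕ}
    (hk2 : 2 ≤ k) (hkb : k ≤ M.card) :
    (((M.powersetCard k).filter fun T => 2 * M.card * (S ∩ T).card ≤ S.card * k).card : ℝ)
      ≤ 4 * (M.card.choose k : ℝ) * M.card / (S.card * k) := by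
  -- notation
  set b := M.card with hb
  set σ := S.card with hσdef
  set N := b.choose k with hN
  set A₁ := (b - 1).choose (k - 1) with hA₁
  set A₂ := (b - 2).choose (k - 2) with hA₂
  have hb2 : 2 ≤ b := hk2.trans hkb
  -- the two binomial identities `b A₁ = k N`, `(b - 1) A₂ = (k - 1) A₁`
  have hid1 : b * A₁ = N * k := by
    have h := Nat.add_one_mul_choose_eq (b - 1) (k - 1)
    rw [Nat.sub_add_cancel (by omega : 1 ≤ b), Nat.sub_add_cancel (by omega : 1 ≤ k)] at h
    rw [hA₁, hN, h]
  have hid2 : (b - 1) * A₂ = A₁ * (k - 1) := by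
    have h := Nat.add_one_mul_choose_eq (b - 2) (k - 2)
    have e1 : b - 2 + 1 = b - 1 := by omega
    have e2 : k - 2 + 1 = k - 1 := by omega
    rw [e1, e2] at h
    rw [hA₂, hA₁, h]
  -- the moments
  have hm1 : ∑ T ∈ M.powersetCard k, (S ∩ T).card = σ * A₁ :=
    sum_card_inter_powersetCard M S hS (by omega)
  have hm2 : ∑ T ∈ M.powersetCard k, (S ∩ T).card * ((S ∩ T).card - 1) = σ * (σ - 1) * A₂ :=
    sum_card_inter_mul_pred_powersetCard M S hS hk2
  have hsq : ∀ n : ℕ, ((n : ℝ)) ^ 2 = (n * (n - 1) : ℕ) + n := by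
    intro n
    rcases n with _ | n
    · simp
    · push_cast [Nat.succ_sub_one]
      ring
  -- real versions
  have hbR : (2 : ℝ) ≤ b := by exact_mod_cast hb2
  have hkR : (2 : ℝ) ≤ k := by exact_mod_cast hk2
  have hkbR : (k : ℝ) ≤ b := by exact_mod_cast hkb
  have hσR : (1 : ℝ) ≤ σ := by exact_mod_cast hσ
  have hNpos : (0 : ℝ) < N := by
    have : 0 < N := Nat.choose_pos hkb
    exact_mod_cast this
  have hid1R : (b : ℝ) * A₁ = N * k := by exact_mod_cast hid1
  have hid2R : ((b : ℝ) - 1) * A₂ = A₁ * ((k : ℝ) - 1) := by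
    have h : (((b - 1 : ℕ) : ℝ)) * A₂ = A₁ * ((k - 1 : ℕ) : ℝ) := by exact_mod_cast hid2
    rwa [Nat.cast_sub (by omega : 1 ≤ b), Nat.cast_sub (by omega : 1 ≤ k), Nat.cast_one] at h
  have hm1R : ∑ T ∈ M.powersetCard k, ((S ∩ T).card : ℝ) = σ * A₁ := by exact_mod_cast hm1
  have hm2R : ∑ T ∈ M.powersetCard k, ((S ∩ T).card : ℝ) ^ 2 = σ * ((σ : ℝ) - 1) * A₂ + σ * A₁ := by
    have h : ∑ T ∈ M.powersetCard k, ((S ∩ T).card : ℝ) ^ 2 =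
        ((∑ T ∈ M.powersetCard k, (S ∩ T).card * ((S ∩ T).card - 1) : ℕ) : ℝ) +
          ∑ T ∈ M.powersetCard k, ((S ∩ T).card : ℝ) := by
      push_cast [Nat.cast_sum]
      rw [← sum_add_distrib]
      refine sum_congr rfl fun T _ => ?_
      rw [hsq]
      push_cast
      ring
    rw [h, hm2, hm1R]
    have : ((σ * (σ - 1) * A₂ : ℕ) : ℝ) = σ * ((σ : ℝ) - 1) * A₂ := by
      rw [Nat.cast_mul, Nat.cast_mul, Nat.cast_sub hσ, Nat.cast_one]
    rw [this]
  -- the mean and the variance bound `∑ (X - μ)² ≤ N μ`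
  set μ : ℝ := σ * k / b with hμ
  have hbpos : (0 : ℝ) < b := by linarith
  have hμpos : 0 < μ := by rw [hμ]; positivity
  have hA₁R : (A₁ : ℝ) = N * k / b := by
    field_simp
    linarith [hid1R]
  have hA₂le : (σ : ℝ) * ((σ : ℝ) - 1) * A₂ ≤ N * μ ^ 2 := by
    -- `σ(σ-1) A₂ = (Nkσ/b) · (σ-1)(k-1)/(b-1) ≤ (Nkσ/b) · σk/b = N μ²`
    have hb1 : (0 : ℝ) < (b : ℝ) - 1 := by linarith
    have h1 : (A₂ : ℝ) * (b * ((b : ℝ) - 1)) = N * k * ((k : ℝ) - 1) := by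
      linear_combination (b : ℝ) * hid2R + ((k : ℝ) - 1) * hid1R
    have hA₂R : (A₂ : ℝ) = N * k * ((k : ℝ) - 1) / (b * ((b : ℝ) - 1)) := by
      rw [eq_div_iff (by positivity)]
      exact h1
    have hkey : ((σ : ℝ) - 1) * ((k : ℝ) - 1) / ((b : ℝ) - 1) ≤ σ * k / b := by
      rw [div_le_div_iff₀ hb1 hbpos]
      nlinarith
    have hL : (σ : ℝ) * ((σ : ℝ) - 1) * A₂ =
        (N * k * σ / b) * (((σ : ℝ) - 1) * ((k : ℝ) - 1) / ((b : ℝ) - 1)) := by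
      rw [hA₂R]
      field_simp
    have hR : (N : ℝ) * μ ^ 2 = (N * k * σ / b) * (σ * k / b) := by
      rw [hμ]
      ring
    rw [hL, hR]
    exact mul_le_mul_of_nonneg_left hkey (by positivity)
  have hvar : ∑ T ∈ M.powersetCard k, (((S ∩ T).card : ℝ) - μ) ^ 2 ≤ N * μ := by
    have hexp : ∑ T ∈ M.powersetCard k, (((S ∩ T).card : ℝ) - μ) ^ 2 =
        ∑ T ∈ M.powersetCard k, ((S ∩ T).card : ℝ) ^ 2 -
          2 * μ * ∑ T ∈ M.powersetCard k, ((S ∩ T).card : ℝ) + N * μ ^ 2 := by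
      rw [mul_sum, ← sum_sub_distrib]
      have hc : (N : ℝ) * μ ^ 2 = ∑ T ∈ M.powersetCard k, μ ^ 2 := by
        rw [sum_const, card_powersetCard, nsmul_eq_mul]
      rw [hc, ← sum_add_distrib]
      exact sum_congr rfl fun T _ => by ring
    rw [hexp, hm2R, hm1R, hA₁R]
    have : 2 * μ * (σ * (N * k / b)) = 2 * (N * μ ^ 2) := by rw [hμ]; ring
    rw [this]
    have : (σ : ℝ) * (N * k / b) = N * μ := by rw [hμ]; ring
    rw [this]
    linarith [hA₂le]
  -- Chebyshev
  set F := (M.powersetCard k).filter fun T => 2 * M.card * (S ∩ T).card ≤ S.card * k with hF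
  have hFle : (F.card : ℝ) * (μ ^ 2 / 4) ≤ N * μ := by
    calc (F.card : ℝ) * (μ ^ 2 / 4) = ∑ T ∈ F, μ ^ 2 / 4 := by rw [sum_const, nsmul_eq_mul]
      _ ≤ ∑ T ∈ F, (((S ∩ T).card : ℝ) - μ) ^ 2 := by
          refine sum_le_sum fun T hT => ?_
          rw [hF, mem_filter] at hT
          have h2 : 2 * (b : ℝ) * (S ∩ T).card ≤ σ * k := by exact_mod_cast hT.2
          have hμb : μ * b = σ * k := by
            rw [hμ]
            field_simp
          have hX2 : 2 * ((S ∩ T).card : ℝ) ≤ μ := by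
            have : (b : ℝ) * (2 * ((S ∩ T).card : ℝ)) ≤ b * μ := by linarith
            exact le_of_mul_le_mul_left this hbpos
          have ha : 0 ≤ μ - 2 * ((S ∩ T).card : ℝ) := by linarith
          have hb' : 0 ≤ 3 * μ - 2 * ((S ∩ T).card : ℝ) := by linarith
          nlinarith [mul_nonneg ha hb']
      _ ≤ ∑ T ∈ M.powersetCard k, (((S ∩ T).card : ℝ) - μ) ^ 2 :=
          sum_le_sum_of_subset_of_nonneg (filter_subset _ _) fun T _ _ => sq_nonneg _
      _ ≤ N * μ := hvar
  have hgoal : (F.card : ℝ) ≤ 4 * N / μ := by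
    rw [le_div_iff₀ hμpos]
    nlinarith [hFle, hμpos]
  calc (F.card : ℝ) ≤ 4 * N / μ := hgoal
    _ = 4 * (N : ℝ) * b / (σ * k) := by
        rw [hμ]
        field_simp

/-- **A `k`-subset that is good for most targets** (the second-moment method summed over the
targets and averaged over the subsets). Let `M` be a finite set of size `b`, `2 ≤ k ≤ b`, and
`Sᵢ ⊆ M` (`i ∈ R`) nonempty targets. Then there is `T ⊆ M` with `|T| = k` such that the number
of targets met by `T` in at most half the expected number of elements (`2b|Sᵢ ∩ T| ≤ |Sᵢ| k`)
is at most `∑_{i ∈ R} 4b / (|Sᵢ| k)`. [cite: GuthKatz2015, §3 (random subset of lines;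
here derandomized by Chebyshev and averaging)] -/
theorem exists_subset_few_small {ι : Type*} (M : Finset α) {k : ℕ} (hk2 : 2 ≤ k)
    (hkb : k ≤ M.card) (R : Finset ι) (S : ι → Finset α) (hS : ∀ i ∈ R, S i ⊆ M)
    (hS1 : ∀ i ∈ R, 1 ≤ (S i).card) :
    ∃ T ⊆ M, T.card = k ∧
      ((R.filter fun i => 2 * M.card * (S i ∩ T).card ≤ (S i).card * k).card : ℝ) ≤
        ∑ i ∈ R, 4 * (M.card : ℝ) / ((S i).card * k) := by
  classical
  set 𝒯 := M.powersetCard k with h𝒯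
  have h𝒯ne : 𝒯.Nonempty := powersetCard_nonempty.2 hkb
  set N := M.card.choose k with hN
  have hNcard : 𝒯.card = N := card_powersetCard _ _
  -- double counting
  have hdc : ∑ T ∈ 𝒯, ((R.filter fun i => 2 * M.card * (S i ∩ T).card ≤ (S i).card * k).card : ℝ)
      ≤ ∑ T ∈ 𝒯, ∑ i ∈ R, 4 * (M.card : ℝ) / ((S i).card * k) := by
    calc ∑ T ∈ 𝒯, ((R.filter fun i => 2 * M.card * (S i ∩ T).card ≤ (S i).card * k).card : ℝ)
        = ∑ T ∈ 𝒯, ∑ i ∈ R,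
            (if 2 * M.card * (S i ∩ T).card ≤ (S i).card * k then (1 : ℝ) else 0) := by
          refine sum_congr rfl fun T _ => ?_
          rw [sum_boole]
      _ = ∑ i ∈ R, ∑ T ∈ 𝒯,
            (if 2 * M.card * (S i ∩ T).card ≤ (S i).card * k then (1 : ℝ) else 0) := sum_comm
      _ = ∑ i ∈ R, ((𝒯.filter fun T => 2 * M.card * (S i ∩ T).card ≤ (S i).card * k).card : ℝ) := by
          refine sum_congr rfl fun i _ => ?_
          rw [sum_boole]
      _ ≤ ∑ i ∈ R, 4 * (N : ℝ) * M.card / ((S i).card * k) :=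
          sum_le_sum fun i hi => card_filter_small_le M (S i) (hS i hi) (hS1 i hi) hk2 hkb
      _ = ∑ T ∈ 𝒯, ∑ i ∈ R, 4 * (M.card : ℝ) / ((S i).card * k) := by
          rw [sum_const, hNcard, nsmul_eq_mul, mul_sum]
          refine sum_congr rfl fun i _ => ?_
          ring
  obtain ⟨T, hT, hle⟩ := exists_le_of_sum_le h𝒯ne hdc
  rw [h𝒯, mem_powersetCard] at hT
  exact ⟨T, hT.1, hT.2, hle⟩

end Chebyshev

end Literature.Combinatorics.Extremal
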